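import Literature.Computability.Cryptography.VanDamSeroussiOracle
import Literature.Computability.Cryptography.VanDamSeroussiUnphase
import Literature.Computability.Cryptography.VanDamSeroussiReference
import HarnessLib

/-!
# The character phases of the van Dam–Seroussi circuit, digit by digit

Topic `Literature/Computability/Cryptography`; support for the discharge of
`VanDamSeroussi2002_gaussSumPhase_qsolvable`. van Dam–Seroussi 2002, §3 Lemma 1 prepare
`|χ⟩ = (p−1)^{-1/2} Σ_y χ(y)|y⟩` from the uniform superposition "by computing the discrete logarithm
`log_g y` with Shor's algorithm and applying the phase `ζ_{p−1}^{α log_g y}`". In the tree's circuit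
the discrete logarithm `d` is fetched from the oracle (`VDSOracle.dlog`), the oracle then spells the
`L` binary digits `A = ⌊2^L frac(a d/(p−1))⌋` of the phase (`VDSOracle.phaseNum`), and the phase is
imprinted as the PRODUCT of the fixed dyadic phases `e(2^m/2^L)` on the digits that are set (each a
Clifford+`T` phase gadget). This file proves the arithmetic of that realisation:

* `Hales2002.e_natCast_div_eq_prod_testBit` — `e(A/2^L) = Π_{m<L} (A_m ? e(2^m/2^L) : 1)` for `A < 2^L`;
* **`norm_e_phaseNum_sub_le`** — `‖e(phaseNum/2^L) − e((a d mod (p−1))/(p−1))‖ ≤ 2π/2^L`;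
* `mulChar_eq_e_of_dlog` — for `χ(g) = e(a/(p−1))` and a unit `y`, `χ(y) = e((a·ind_g y mod (p−1))/(p−1))`,
  hence **`norm_e_phaseNum_dlog_sub_mulChar_le`**: the imprinted phase is within `2π/2^L` of `χ(y)`;
  `norm_digitPhase_sub_unphase_le` — the same against `VanDamSeroussi.unphase χ` (value `1` at `y = 0`,
  where the oracle answers `d = 0`);
* `quadCharC_primitiveRoot_eq_e` — the reference branch: `η(g) = −1 = e(((p−1)/2)/(p−1))`, so the same
  digits with `a = (p−1)/2` (`VDSOracle.expOf p a true`) imprint the quadratic character.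

Everything is proved; no definition, no named fact.

## References

* W. van Dam, G. Seroussi, arXiv:quant-ph/0207131 (2002), §3 Lemma 1, §2.1 (χ(g^j) = ζ^{αj})
  [VanDamSeroussi2002].
* M. A. Nielsen, I. L. Chuang, *Quantum Computation and Quantum Information*, CUP 2010, §5.1
  (phases from binary fractions, eq. (5.4)) [NielsenChuang2010].
-/

noncomputable section

open Finset Real Complex

namespace Literature.Computability.Cryptography

namespace Hales2002

/-! ### A phase from its binary digits -/

/-- **A dyadic phase is the product of the phases of its digits**: for `A < 2^L`,
`e(A/2^L) = Π_{m<L} (if bit m of A then e(2^m/2^L) else 1)`. [cite: NielsenChuang2010, §5.1 eq. (5.4)] -/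
theorem e_natCast_div_eq_prod_testBit (L : ℕ) : ∀ {A : ℕ}, A < 2 ^ L →
    e ((A : ℝ) / 2 ^ L) = ∏ m ∈ range L, (if A.testBit m then e ((2 : ℝ) ^ m / 2 ^ L) else 1) := by
  -- by induction on the number of digits read, for the truncations `A mod 2^n`
  suffices key : ∀ n A : ℕ, e (((A % 2 ^ n : ℕ) : ℝ) / 2 ^ L) = ∏ m ∈ range n, (if A.testBit m then e ((2 : ℝ) ^ m / 2 ^ L) else 1) by
    intro A hA
    have := key L A
    rwa [Nat.mod_eq_of_lt hA] at this
  have e0 : e 0 = 1 := by simpa using e_intCast 0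
  intro n A
  induction n with
  | zero => rw [prod_range_zero, pow_zero, Nat.mod_one, Nat.cast_zero, zero_div, e0]
  | succ n ih =>
    rw [prod_range_succ, ← ih, Nat.mod_pow_succ, ← Nat.toNat_testBit]
    cases A.testBit n
    · simp
    · simp only [Bool.toNat_true, mul_one, ↓reduceIte]
      rw [← e_add]
      congr 1
      push_cast
      ring

end Hales2002

namespace VanDamSeroussi

open Hales2002 VDSOracle

variable {p : ℕ} [hp : Fact p.Prime]

/-! ### The digits approximate the phase -/

/-- **The spelled digits approximate the phase fraction**: `‖e(phaseNum p a L d/2^L) − e((a d mod (p−1))/(p−1))‖ ≤ 2π/2^L`.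
[cite: VanDamSeroussi2002, §3 Lemma 1] [cite: NielsenChuang2010, §5.1 (finite binary fractions)] -/
theorem norm_e_phaseNum_sub_le (a L d : ℕ) :
    ‖e ((phaseNum p a L d : ℝ) / 2 ^ L) - e (((a * d % (p - 1) : ℕ) : ℝ) / ((p : ℝ) - 1))‖ ≤ 2 * π / 2 ^ L := by
  have hp2 : 2 ≤ p := hp.out.two_le
  obtain ⟨h1, h2⟩ := phaseNum_div_le hp2 a L d
  set u : ℝ := (phaseNum p a L d : ℝ) / 2 ^ L with hu
  set v : ℝ := ((a * d % (p - 1) : ℕ) : ℝ) / ((p : ℝ) - 1) with hv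
  have hdiff : |u - v| ≤ 1 / 2 ^ L := by
    rw [abs_sub_comm, abs_of_nonneg (by linarith)]
    linarith
  have h : e u - e v = e v * (e (u - v) - 1) := by rw [mul_sub, mul_one, ← e_add, add_sub_cancel]
  rw [h]
  calc ‖e v * (e (u - v) - 1)‖ ≤ 2 * π * |u - v| := norm_e_mul_e_sub_one_le _ _
    _ ≤ 2 * π * (1 / 2 ^ L) := by gcongr
    _ = 2 * π / 2 ^ L := by ring

/-- **The character at a unit through its discrete logarithm**: for `χ(g) = e(a/(p−1))` on an instance
`(p, g, y)`, `χ(y) = e((a · ind_g y mod (p−1))/(p−1))`. [cite: VanDamSeroussi2002, §2.1 and §3 Lemma 1] -/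
theorem mulChar_eq_e_of_dlog (χ : MulChar (ZMod p) ℂ) {g y a : ℕ} (hχ : χ (g : ZMod p) = e ((a : ℝ) / ((p : ℝ) - 1)))
    (h : IsDLogInstance p g y) :
    χ (y : ZMod p) = e (((a * dlog p g y % (p - 1) : ℕ) : ℝ) / ((p : ℝ) - 1)) := by
  rw [← natCast_pow_dlog h, mulChar_pow_eq_e_mod χ hχ]

/-- **The imprinted phase is within `2π/2^L` of the character value** at a unit `y`.
[cite: VanDamSeroussi2002, §3 Lemma 1] -/
theorem norm_e_phaseNum_dlog_sub_mulChar_le (χ : MulChar (ZMod p) ℂ) {g y a : ℕ}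
    (hχ : χ (g : ZMod p) = e ((a : ℝ) / ((p : ℝ) - 1))) (h : IsDLogInstance p g y) (L : ℕ) :
    ‖e ((phaseNum p a L (dlog p g y) : ℝ) / 2 ^ L) - χ (y : ZMod p)‖ ≤ 2 * π / 2 ^ L := by
  rw [mulChar_eq_e_of_dlog χ hχ h]
  exact norm_e_phaseNum_sub_le a L _

/-- **The imprinted phase against the ideal un-phasing multiplier** on `k < p`: with `d = ind_g k` for a
unit and `d = 0` at `k = 0` (the oracle's answer off the units), the phase `e(phaseNum p a L d/2^L)` is
within `2π/2^L` of `unphase χ k`. [cite: VanDamSeroussi2002, §4 Algorithm 1 (the phase change)] -/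
theorem norm_digitPhase_sub_unphase_le (χ : MulChar (ZMod p) ℂ) {g a : ℕ} (hg0 : 0 < g) (hgp : g < p)
    (hord : orderOf (g : ZMod p) = p - 1) (hχ : χ (g : ZMod p) = e ((a : ℝ) / ((p : ℝ) - 1))) (L : ℕ) {k : ℕ} (hk : k < p) :
    ‖e ((phaseNum p a L (if k = 0 then 0 else dlog p g k) : ℝ) / 2 ^ L) - unphase χ k‖ ≤ 2 * π / 2 ^ L := by
  unfold unphase
  split_ifs with h0
  · -- `k = 0`: no digits, phase `1`
    have : phaseNum p a L 0 = 0 := by simp [phaseNum]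
    have e0 : e 0 = 1 := by simpa using e_intCast 0
    rw [this, Nat.cast_zero, zero_div, e0, sub_self, norm_zero]
    positivity
  · exact norm_e_phaseNum_dlog_sub_mulChar_le χ hχ ⟨hp.out, hg0, hgp, hord, Nat.pos_of_ne_zero h0, hk⟩ L

/-! ### The reference branch -/

/-- **The quadratic character at the primitive root as a phase**: `η(g) = e(((p−1)/2)/(p−1)) = −1` for an
odd prime `p` — so the digits of branch `1` (`VDSOracle.expOf p a true = (p−1)/2`) imprint `η`.
[cite: VanDamSeroussi2002, §2.2 (quadratic characters: χ(g^j) = (−1)^j)] -/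
theorem quadCharC_primitiveRoot_eq_e (hp2 : p ≠ 2) {g : ZMod p} (hg : IsPrimitiveRoot g (p - 1)) :
    Literature.NumberTheory.EllipticCurves.ModularForms.quadCharC p g = e (((((p - 1) / 2 : ℕ)) : ℝ) / ((p : ℝ) - 1)) := by
  rw [quadCharC_primitiveRoot hp2 hg, e_eq_cexp, ← exp_quadratic_exponent hp2]
  congr 1
  push_cast
  ring

/-- The exponent of branch `1` is `(p−1)/2`, that of branch `0` is `a`. [folklore] -/
theorem expOf_true (p a : ℕ) : expOf p a true = (p - 1) / 2 := rfl

/-- The exponent of branch `0`. [folklore] -/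
theorem expOf_false (p a : ℕ) : expOf p a false = a := rfl

end VanDamSeroussi

end Literature.Computability.Cryptography

end
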